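import Literature.AnabelianGeometry.SemiGraphs.TemperedPiEdgeConjugatorsChart
import Literature.AnabelianGeometry.SemiGraphs.ArithOuterActionOfGraphAction
import HarnessLib

/-!
# [SemiAnbd] Thm 5.4, producer row T54-B: `hP` at an ARBITRARY cofinal Galois tower and its chart, from a
# GRAPH ACTION alone (E1-junction currency)

Mochizuki, *Semi-graphs of anabelioids*, Publ. RIMS **42** (2006), §5 Def 5.1 (i) p. 62, Prop 5.2 (iv)
p. 64, Thm 5.4 p. 66 [cite: MochizukiSemiAnbd2006, Thm 5.4, p. 66].  abc-iut cell, layer L3, GAP-LEDGER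
row G-w4d053-1 (T54-B), E1 junction (J3); seat abc-iut-w4-d053 gen 3.  PROOF-ONLY composition (no
definition, no named fact) of abc-iut-w4-d082's `exists_outerAction_binders_of_graphAction` — generic in
the chart, here taken at the chart `D.chart …` of an arbitrary cofinal Galois tower `D` (abc-iut-L3-t9,
GaloisLevelDataChart.lean) — with this seat's `isArithCompatible_piPresentation_outerAction_of_branchPair_chart`
(TemperedPiEdgeConjugatorsChart.lean):

* `exists_outerAction_isArithCompatible_of_graphAction_chart` (+ `_of_finite`) — for a pseudo-functorial,
  locally surjective action `F` of `Π_A` on `𝒢` over `baseAct` (pseudo-functoriality read through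
  `D.chart`), there is an outer action `ρ : Π_A → Out(π₁^temp 𝒢)` on the group of the tower `D` with the
  Def 5.1 (i) chart binders `hV`, `hE`, `hBR` at `D.chart` AND `IsArithCompatible` of the presentation
  `D.piPresentation T R` with the outer model — the `hP` input of the Thm 5.4 capstone at the
  characteristic tower, with NO binder on `π₁^temp(𝒢)`-level data.

Nothing here takes a side on [IUTchIII] Cor 3.12; typed ≠ proved for Thm 5.4.
-/

namespace Literature.AnabelianGeometry.SemiGraphs

namespace ProfiniteSemiGraph

open CategoryTheory
open Literature.AnabelianGeometry.EtaleTheta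

universe u w

variable {𝒢 : ProfiniteSemiGraph.{u}} (D : GaloisLevelData 𝒢) (h𝒢 : 𝒢.IsCountable)
  (hcof : ∀ (T : CovObj 𝒢), T.IsTempered → ∀ p : T.Point,
    ∃ i : ℕ, ∀ j, i ≤ j → (D.S j).Splits (T.component p))
  (hcn : 𝒢.graph.IsConnected) (hS : ∀ n, (D.S n).Splits (D.S n)) (hfin : ∀ n, (D.S n).IsFinite)
  (hne : ∀ n, (D.S n).HasNonemptyFibres)
  (T : ∀ w : 𝒢.graph.Vertex, D.PointSeq h𝒢 w) (R : SemiGraph.RefBranches 𝒢.graph)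
  {PA : Type w} [Group PA] (F : PA → Hom 𝒢 𝒢) (baseAct : PA →* Aut 𝒢.graph)

/-- **`hP` at the tower `D` from a graph action alone**: an outer action `ρ` on `D.temperedPi` with the
Def 5.1 (i) chart binders `hV`, `hE`, `hBR` at `D.chart` AND `IsArithCompatible` of `D.piPresentation T R`
with `π₁^temp(𝒢) ⋊^out_ρ Π_A`, for `𝒢` under the Thm 3.7 hypotheses, a graph, with Thm 3.7 (iii) at `𝒢`.
[cite: MochizukiSemiAnbd2006, Thm 5.4, p. 66] -/
theorem exists_outerAction_isArithCompatible_of_graphAction_chart (h37 : 𝒢.Thm37Hypotheses)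
    (hG : 𝒢.graph.IsGraph) (hCIV : CompactInVerticialAt 𝒢) (hbase : ∀ a, (F a).base = (baseAct a).hom)
    (hmul : ∀ a b, Nonempty ((F (a * b)).chartPullback (D.chart h𝒢 hcof hcn hS hfin hne) (D.chart h𝒢 hcof hcn hS hfin hne) ≅
      (F a).chartPullback (D.chart h𝒢 hcof hcn hS hfin hne) (D.chart h𝒢 hcof hcn hS hfin hne) ⋙ (F b).chartPullback (D.chart h𝒢 hcof hcn hS hfin hne) (D.chart h𝒢 hcof hcn hS hfin hne)))
    (hone : Nonempty ((F 1).chartPullback (D.chart h𝒢 hcof hcn hS hfin hne) (D.chart h𝒢 hcof hcn hS hfin hne) ≅ 𝟭 (BTemp (D.chart h𝒢 hcof hcn hS hfin hne).G)))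
    (hVs : ∀ a v, Function.Surjective ((F a).hV v)) (hEs : ∀ a e, Function.Surjective ((F a).hE e)) :
    ∃ ρ : PA →* TopOut (D.chart h𝒢 hcof hcn hS hfin hne).G,
      (∀ (a : PA) (v : 𝒢.graph.Vertex) (H : Subgroup (D.chart h𝒢 hcof hcn hS hfin hne).G), H ∈ verticialSubgroups (D.chart h𝒢 hcof hcn hS hfin hne) v →
        ∃ Φ : contMulAut (D.chart h𝒢 hcof hcn hS hfin hne).G, TopOut.mk _ Φ = ρ a ∧
          H.map (Φ : MulAut (D.chart h𝒢 hcof hcn hS hfin hne).G).toMonoidHom ∈ verticialSubgroups (D.chart h𝒢 hcof hcn hS hfin hne) ((baseAct a).hom.vertexMap v)) ∧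
      (∀ (a : PA) (e : 𝒢.graph.Edge) (K : Subgroup (D.chart h𝒢 hcof hcn hS hfin hne).G), K ∈ edgeLikeSubgroups (D.chart h𝒢 hcof hcn hS hfin hne) e →
        ∃ Φ : contMulAut (D.chart h𝒢 hcof hcn hS hfin hne).G, TopOut.mk _ Φ = ρ a ∧
          K.map (Φ : MulAut (D.chart h𝒢 hcof hcn hS hfin hne).G).toMonoidHom ∈ edgeLikeSubgroups (D.chart h𝒢 hcof hcn hS hfin hne) ((baseAct a).hom.edgeMap e)) ∧
      (∀ (a : PA) (b : 𝒢.graph.Branch) (v : 𝒢.graph.Vertex) (hb : 𝒢.graph.abuts b = some v)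
        (φ : 𝒢.Gv v →ₜ* (D.chart h𝒢 hcof hcn hS hfin hne).G), IsVerticialHom (D.chart h𝒢 hcof hcn hS hfin hne) v φ →
        ∃ Φ : contMulAut (D.chart h𝒢 hcof hcn hS hfin hne).G, TopOut.mk _ Φ = ρ a ∧
          ∃ φ' : 𝒢.Gv ((baseAct a).hom.vertexMap v) →ₜ* (D.chart h𝒢 hcof hcn hS hfin hne).G,
            IsVerticialHom (D.chart h𝒢 hcof hcn hS hfin hne) ((baseAct a).hom.vertexMap v) φ' ∧ ∃ x' : (D.chart h𝒢 hcof hcn hS hfin hne).G,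
              Subgroup.map (Φ : MulAut (D.chart h𝒢 hcof hcn hS hfin hne).G).toMonoidHom φ.toMonoidHom.range =
                Subgroup.map (MulAut.conj x').toMonoidHom φ'.toMonoidHom.range ∧
              Subgroup.map (Φ : MulAut (D.chart h𝒢 hcof hcn hS hfin hne).G).toMonoidHom
                  (Subgroup.map φ.toMonoidHom (𝒢.branchSubgroup b v hb)) =
                Subgroup.map (MulAut.conj x').toMonoidHom (Subgroup.map φ'.toMonoidHom
                  (𝒢.branchSubgroup ((baseAct a).hom.branchMap b) ((baseAct a).hom.vertexMap v)
                    ((baseAct a).hom.abuts_branchMap b v hb)))) ∧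
      (D.piPresentation h𝒢 T R).IsArithCompatible
        (((contMulAut (D.chart h𝒢 hcof hcn hS hfin hne).G).subtype.comp (MonoidHom.fst _ _)).comp (outerSemidirectProduct ρ).subtype)
        (baseAct.comp (outerSemidirectProductSnd ρ)) := by
  obtain ⟨ρ, hV, hE, hBR⟩ := exists_outerAction_binders_of_graphAction (D.chart h𝒢 hcof hcn hS hfin hne) F h37.toProp36Hypotheses hG
    hmul hone hVs hEs
  have hV' : ∀ (a : PA) (v : 𝒢.graph.Vertex) (H : Subgroup (D.chart h𝒢 hcof hcn hS hfin hne).G), H ∈ verticialSubgroups (D.chart h𝒢 hcof hcn hS hfin hne) v →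
      ∃ Φ : contMulAut (D.chart h𝒢 hcof hcn hS hfin hne).G, TopOut.mk _ Φ = ρ a ∧
        H.map (Φ : MulAut (D.chart h𝒢 hcof hcn hS hfin hne).G).toMonoidHom ∈ verticialSubgroups (D.chart h𝒢 hcof hcn hS hfin hne) ((baseAct a).hom.vertexMap v) := by
    intro a v H hH
    rw [← hbase a]
    exact hV a v H hH
  have hE' : ∀ (a : PA) (e : 𝒢.graph.Edge) (K : Subgroup (D.chart h𝒢 hcof hcn hS hfin hne).G), K ∈ edgeLikeSubgroups (D.chart h𝒢 hcof hcn hS hfin hne) e →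
      ∃ Φ : contMulAut (D.chart h𝒢 hcof hcn hS hfin hne).G, TopOut.mk _ Φ = ρ a ∧
        K.map (Φ : MulAut (D.chart h𝒢 hcof hcn hS hfin hne).G).toMonoidHom ∈ edgeLikeSubgroups (D.chart h𝒢 hcof hcn hS hfin hne) ((baseAct a).hom.edgeMap e) := by
    intro a e K hK
    rw [← hbase a]
    exact hE a e K hK
  have hBR' : ∀ (a : PA) (b : 𝒢.graph.Branch) (v : 𝒢.graph.Vertex) (hb : 𝒢.graph.abuts b = some v)
      (φ : 𝒢.Gv v →ₜ* (D.chart h𝒢 hcof hcn hS hfin hne).G), IsVerticialHom (D.chart h𝒢 hcof hcn hS hfin hne) v φ →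
      ∃ Φ : contMulAut (D.chart h𝒢 hcof hcn hS hfin hne).G, TopOut.mk _ Φ = ρ a ∧
        ∃ φ' : 𝒢.Gv ((baseAct a).hom.vertexMap v) →ₜ* (D.chart h𝒢 hcof hcn hS hfin hne).G,
          IsVerticialHom (D.chart h𝒢 hcof hcn hS hfin hne) ((baseAct a).hom.vertexMap v) φ' ∧ ∃ x' : (D.chart h𝒢 hcof hcn hS hfin hne).G,
            Subgroup.map (Φ : MulAut (D.chart h𝒢 hcof hcn hS hfin hne).G).toMonoidHom φ.toMonoidHom.range =
              Subgroup.map (MulAut.conj x').toMonoidHom φ'.toMonoidHom.range ∧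
            Subgroup.map (Φ : MulAut (D.chart h𝒢 hcof hcn hS hfin hne).G).toMonoidHom
                (Subgroup.map φ.toMonoidHom (𝒢.branchSubgroup b v hb)) =
              Subgroup.map (MulAut.conj x').toMonoidHom (Subgroup.map φ'.toMonoidHom
                (𝒢.branchSubgroup ((baseAct a).hom.branchMap b) ((baseAct a).hom.vertexMap v)
                  ((baseAct a).hom.abuts_branchMap b v hb))) := by
    intro a b v hb φ hφ
    rw [← hbase a]
    exact hBR a b v hb φ hφ
  exact ⟨ρ, hV', hE', hBR', isArithCompatible_piPresentation_outerAction_of_branchPair_chart D h𝒢 hcof hcn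
    hS hfin hne T R ρ baseAct h37 hG hCIV hV' hBR'⟩

/-- The same at a FINITE graph (Thm 3.7 (iii) at `𝒢` := abc-iut-L3-t8's `compactInVerticialAt_of_finiteGraph`),
conclusion `IsArithCompatible` only: **`hP` at ANY tower from a graph action, no further hypothesis**.
[cite: MochizukiSemiAnbd2006, Thm 5.4, p. 66] -/
theorem exists_outerAction_isArithCompatible_of_graphAction_chart_of_finite [Finite 𝒢.graph.Vertex]
    [Finite 𝒢.graph.Edge] (h37 : 𝒢.Thm37Hypotheses) (hG : 𝒢.graph.IsGraph)
    (hbase : ∀ a, (F a).base = (baseAct a).hom)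
    (hmul : ∀ a b, Nonempty ((F (a * b)).chartPullback (D.chart h𝒢 hcof hcn hS hfin hne) (D.chart h𝒢 hcof hcn hS hfin hne) ≅
      (F a).chartPullback (D.chart h𝒢 hcof hcn hS hfin hne) (D.chart h𝒢 hcof hcn hS hfin hne) ⋙ (F b).chartPullback (D.chart h𝒢 hcof hcn hS hfin hne) (D.chart h𝒢 hcof hcn hS hfin hne)))
    (hone : Nonempty ((F 1).chartPullback (D.chart h𝒢 hcof hcn hS hfin hne) (D.chart h𝒢 hcof hcn hS hfin hne) ≅ 𝟭 (BTemp (D.chart h𝒢 hcof hcn hS hfin hne).G)))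
    (hVs : ∀ a v, Function.Surjective ((F a).hV v)) (hEs : ∀ a e, Function.Surjective ((F a).hE e)) :
    ∃ ρ : PA →* TopOut (D.chart h𝒢 hcof hcn hS hfin hne).G,
      (D.piPresentation h𝒢 T R).IsArithCompatible
        (((contMulAut (D.chart h𝒢 hcof hcn hS hfin hne).G).subtype.comp (MonoidHom.fst _ _)).comp (outerSemidirectProduct ρ).subtype)
        (baseAct.comp (outerSemidirectProductSnd ρ)) := by
  obtain ⟨ρ, -, -, -, hP⟩ := exists_outerAction_isArithCompatible_of_graphAction_chart D h𝒢 hcof hcn hS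
    hfin hne T R F baseAct h37 hG 𝒢.compactInVerticialAt_of_finiteGraph hbase hmul hone hVs hEs
  exact ⟨ρ, hP⟩

end ProfiniteSemiGraph

end Literature.AnabelianGeometry.SemiGraphs
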